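import Summits.NavierStokesRegularity.NavierStokesRegularity.Theses.DssFarFieldSlaving
import Summits.NavierStokesRegularity.NavierStokesRegularity.Theses.QuantisedSymmetry
import Summits.NavierStokesRegularity.NavierStokesRegularity.Theses.QuarterTurnRdss
import Summits.NavierStokesRegularity.NavierStokesRegularity.Theses.CirculationRelay
import Summits.NavierStokesRegularity.NavierStokesRegularity.Theses.MirrorChamber
import Summits.NavierStokesRegularity.NavierStokesRegularity.Theses.CorkscrewDynamo
import Summits.NavierStokesRegularity.NavierStokesRegularity.Theses.FilamentSkeletonRss
import Summits.NavierStokesRegularity.NavierStokesRegularity.Theses.EulerMelnikovDss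
import Literature.Analysis.FluidPDE.TsaiSelfSimilarHolds
import Literature.Analysis.FluidPDE.TypeIAncientMild

/-!
# Strategist sketch for crux `BlowupTypeIDssProfile` (stmt-NavierStokesRegularity-0155)

Typed objects of `STRATEGY-CENSUS.md` (crux-strategist seat
`cstrat-stmt-NavierStokesRegularity-0155-s2`, 2026-08-17). Everything here elaborates; the
theorems are PROVED (no `sorry`): (§1) the HUB LATTICE — every negative-side profile crux of the
summit implies this crux in a few lines, so every line for any of them is a line for this item;
(§2) the strengthenings of §Strengthen as signatures, with the steady one REFUTED in tree;
(§3) the runner-up decomposition of §Decomposition (final-trace rigidity) as signatures.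
-/

noncomputable section

namespace Summit.NavierStokesRegularity.NavierStokesRegularity.Cruxes.BlowupTypeIDssProfile.Strategist

open MeasureTheory Set Function Filter Topology
open Literature.Analysis.FluidPDE
open _root_.Summit.NavierStokesRegularity.NavierStokesRegularity.Theses

set_option linter.dupNamespace false

local notation "ℝ³" => EuclideanSpace ℝ (Fin 3)

/-- The crux (route DssFarFieldSlaving's decl; `Iff.rfl` with `Blowup.BlowupTypeIDssProfile`). -/
abbrev Crux : Prop := DssFarFieldSlaving.BlowupTypeIDssProfile

/-- The two route copies of the item are the same proposition. -/
theorem crux_iff_blowup : Crux ↔ Blowup.BlowupTypeIDssProfile := Iff.rfl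

/-! ## §1 The hub lattice: sibling ∃-cruxes ⇒ stmt-0155 (all proved) -/

/-- `QuantisedSymmetry.PolyhedralDssProfileExists` (stmt-1404) ⇒ crux: drop the symmetry. -/
theorem of_polyhedral (h : QuantisedSymmetry.PolyhedralDssProfileExists) : Crux := by
  obtain ⟨G, -, -, -, c, hc, u, hmild, hmeas, hdss, hdec, -, hnz⟩ := h
  intro hwall
  exact hnz ((hwall c).1 hc u hmild hmeas hdss hdec)

/-- `CirculationRelay.OhRelayProfileExists` (stmt-1534) ⇒ crux. -/
theorem of_ohRelay (h : CirculationRelay.OhRelayProfileExists) : Crux := by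
  obtain ⟨c, hc, u, hmild, hmeas, hdss, hdec, -, hnz⟩ := h
  intro hwall
  exact hnz ((hwall c).1 hc u hmild hmeas hdss hdec)

/-- `MirrorChamber.ChamberDssProfile` (stmt-1598) ⇒ crux. -/
theorem of_chamber (h : MirrorChamber.ChamberDssProfile) : Crux := by
  obtain ⟨c, hc, u, hmild, hmeas, hdss, hdec, -, hnz⟩ := h
  intro hwall
  exact hnz ((hwall c).1 hc u hmild hmeas hdss hdec)

/-- `QuarterTurnRdss.QuarterTurnProfileExists` (stmt-1100) ⇒ crux: the rotated branch. -/
theorem of_quarterTurn (h : QuarterTurnRdss.QuarterTurnProfileExists) : Crux := by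
  obtain ⟨c, hc, R, -, u, hmild, hmeas, hrdss, hdec, hnz, -⟩ := h
  intro hwall
  exact hnz ((hwall c).2 R hc u hmild hmeas hrdss hdec)

/-- `CorkscrewDynamo.CorkscrewProfile` (stmt-11282) ⇒ crux: the rotated branch. -/
theorem of_corkscrew (h : CorkscrewDynamo.CorkscrewProfile) : Crux := by
  obtain ⟨c, θ, R, u, hc, -, hmild, hmeas, hrdss, hdec, -, hnz⟩ := h
  intro hwall
  exact hnz ((hwall c).2 R hc u hmild hmeas hrdss hdec)

/-- `EulerMelnikovDss.FastBranchProfiles` (stmt-1414) ⇒ crux: one fast branch suffices. -/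
theorem of_fastBranch (h : EulerMelnikovDss.FastBranchProfiles) : Crux := by
  obtain ⟨c, -, -, R, hR⟩ := h 1 one_pos
  intro hwall
  exact hR ((hwall c).2 R)

/-- `FilamentSkeletonRss.RssProfileExists` (stmt-16274, the RSS STRENGTHENING S⁺₂ of
§Strengthen: a steady profile in a rotating Leray frame, Pineau–Vicol Conj. 1.1 negated in the
window `α ≈ 1`) ⇒ crux: an RSS field is rotated-DSS for every factor; take `c = 2`. -/
theorem of_rss (h : FilamentSkeletonRss.RssProfileExists) : Crux := by
  obtain ⟨α, C₀, U, Rot, u, -, -, hU2, hU0, hu1, hrss, hmild, hmeas, hC⟩ := h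
  intro hwall
  have hzero := (hwall 2).2 (Rot (-(α * (2 * Real.log 2)))) one_lt_two u hmild hmeas (hrss 2 two_pos)
    ⟨C₀, hC⟩
  have h1 := hzero (-1) (by norm_num)
  rw [hu1] at h1
  exact hU0 ((Continuous.ae_eq_iff_eq volume hU2.continuous continuous_const).1 h1)

/-- Hence the whole filament-skeleton line (`SkeletonEquilibrium`, `CoreGluing`: stmt-15400/15401)
is a line for THIS crux. -/
theorem of_skeleton (hK1 : FilamentSkeletonRss.SkeletonEquilibrium)
    (hK2 : FilamentSkeletonRss.CoreGluing) : Crux :=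
  of_rss (hK2 hK1)

/-! ## §2 Strengthenings as signatures -/

/-- **S⁺₁ (steady = exactly self-similar Type-I profile).** A nontrivial `C²` Leray profile with
`ν = 1`, `a = 1/2` (the backward Leray system `−ΔU + ½U + ½y·∇U + U·∇U + ∇P = 0`) in `L⁴`
(Type-I decay `|U| ≲ 1/(1+|y|)` gives `U ∈ L⁴`). -/
def SteadyTypeIProfile : Prop :=
  ∃ (U : ℝ³ → ℝ³) (P : ℝ³ → ℝ), IsLerayProfile 1 (1 / 2) U P ∧ MemLp U 4 volume ∧ U ≠ 0

/-- S⁺₁ is REFUTED in tree: Tsai 1998 Thm 1 at `q = 4` (`tsai_selfsimilar_holds`). -/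
theorem not_steadyTypeIProfile : ¬ SteadyTypeIProfile := by
  rintro ⟨U, P, hprof, hU4, hU0⟩
  exact hU0 (tsai_selfsimilar_holds one_pos (by norm_num) hprof (q := 4) (by norm_num)
    (by simp) hU4)

/-- **S⁺₂ (rotating wave / RSS, Perelman's ansatz)** — typed in tree as the sibling target
`FilamentSkeletonRss.RssProfileExists`; OPEN for `α ≈ 1` (Pineau–Vicol 2026 Thm 1.4 removes
`|α| < α_(C₀)` and `|α| > ᾱ(C₀)`). `of_rss` above is the glue S⁺₂ → crux. -/
abbrev RssTypeIProfile : Prop := FilamentSkeletonRss.RssProfileExists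

/-- **S⁺₄ (faster-than-Type-I tail).** A nontrivial `c`-DSS ancient mild solution whose decay
beats the Type-I envelope by a scale-invariant power `δ > 0`:
`‖u(t,x)‖ ≤ C (−t)^{δ/2} / (‖x‖ + √(−t))^{1+δ}`. Its final trace `lim_{t→0⁻} u(t,x)` vanishes for
every `x ≠ 0`, so ESS backward uniqueness across `t = 0` outside a ball (tree track
`ess_backward_uniqueness`, Seregin 2014 App. A) followed by unique continuation forces `u ≡ 0`:
the strengthening EMPTIES the class — recorded, not landed (the refutation is the L³,∞-endpoint
machinery; informative necessary condition: a witness has an EXACT `|y|⁻¹` tail with a nonzero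
log-periodic angular trace). -/
def FasterDecayDssProfile : Prop :=
  ∃ c : ℝ, 1 < c ∧ ∃ (u : ℝ → ℝ³ → ℝ³) (C δ : ℝ), 0 < δ ∧
    IsAncientMildSolution 1 u ∧ (∀ t < 0, AEStronglyMeasurable (u t) volume) ∧
    IsDiscretelySelfSimilar c u ∧
    (∀ t < 0, ∀ x, ‖u t x‖ ≤ C * (-t) ^ (δ / 2) / (‖x‖ + Real.sqrt (-t)) ^ (1 + δ)) ∧
    ¬ (∀ t < 0, u t =ᵐ[volume] 0)

/-! ## §3 Runner-up decomposition (typed, not filed): final-trace rigidity -/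

/-- Final trace of an ancient field at the singular time, off the centre. -/
def HasFinalTrace (u : ℝ → ℝ³ → ℝ³) (g : ℝ³ → ℝ³) : Prop :=
  ∀ x : ℝ³, x ≠ 0 → Tendsto (fun t => u t x) (𝓝[<] 0) (𝓝 (g x))

/-- **B1 (∃, open, no easier than the crux):** a nontrivial Type-I ancient field in the KNSS
gauge, normalised to vanish for `t ≥ 0`, whose final trace is `c`-homogeneous of degree `−1`
(`c g(cx) = g(x)`) — a symmetry of ONE time slice (the singular one) instead of the whole field. -/
def TraceHomogeneousProfileExists : Prop :=
  ∃ c : ℝ, 1 < c ∧ ∃ (u : ℝ → ℝ³ → ℝ³) (g : ℝ³ → ℝ³) (C₀ : ℝ),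
    IsTypeIAncientMild C₀ u ∧ HasTypeIDecay C₀ u ∧ (∀ t, 0 ≤ t → u t = 0) ∧
    HasFinalTrace u g ∧ (∀ x, c • g (c • x) = g x) ∧ ∃ x, u (-1) x ≠ 0

/-- **B2 (rigidity, open, scale-critical): backward uniqueness from the singular time.** Two
Type-I ancient fields in the KNSS gauge with the same final trace coincide on `t < 0`. The
`g = 0` case is ESS 2003 (blow-up profiles with vanishing final vorticity are trivial); the general
case is NOT a corollary: the vorticity of the difference `w` obeys
`η_t − Δη = −curl(η × u₁) − curl(ω₂ × w)` whose last term contains `w`, `∇w` (non-local in `η`),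
and the energy-class log-convexity (Bardos–Tartar) has Grönwall factor `exp ∫ ‖∇u‖_∞ ~ ∫ dt/(−t)`,
divergent at the singular time, while the traces give only the finite vanishing order
`‖w(t)‖_{L²} ≲ |t|^{1/4}`. Composition: B1 ∧ B2 ⇒ crux (apply B2 to `u` and `nsRescale c u`,
which share the trace by homogeneity — `HasTypeIDecay.nsRescale`, `IsAncientMildSolution.nsRescale_holds`
— so `u` is `c`-DSS on `t < 0`, hence everywhere after the normalisation). -/
def FinalTraceRigidity : Prop :=
  ∀ (u₁ u₂ : ℝ → ℝ³ → ℝ³) (g : ℝ³ → ℝ³) (C₁ C₂ : ℝ),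
    IsTypeIAncientMild C₁ u₁ → IsTypeIAncientMild C₂ u₂ → HasTypeIDecay C₁ u₁ → HasTypeIDecay C₂ u₂ →
    HasFinalTrace u₁ g → HasFinalTrace u₂ g → ∀ t < 0, ∀ x, u₁ t x = u₂ t x

/-- Sanity: the trace of the rescaled field is the rescaled trace (the identity the composition
B1 ∧ B2 ⇒ crux runs on). [folklore] -/
theorem hasFinalTrace_nsRescale {u : ℝ → ℝ³ → ℝ³} {g : ℝ³ → ℝ³} (h : HasFinalTrace u g) {c : ℝ}
    (hc : 0 < c) : HasFinalTrace (nsRescale c u) (fun x => c • g (c • x)) := by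
  intro x hx
  have hcx : c • x ≠ 0 := smul_ne_zero hc.ne' hx
  have hlim := h (c • x) hcx
  -- `t ↦ c² t` maps `𝓝[<] 0` into itself
  have hmap : Tendsto (fun t : ℝ => c ^ 2 * t) (𝓝[<] (0 : ℝ)) (𝓝[<] (0 : ℝ)) := by
    refine tendsto_nhdsWithin_of_tendsto_nhds_of_eventually_within _ ?_ ?_
    · have : Tendsto (fun t : ℝ => c ^ 2 * t) (𝓝 0) (𝓝 (c ^ 2 * 0)) :=
        (continuous_const.mul continuous_id).tendsto 0
      rw [mul_zero] at this
      exact this.mono_left nhdsWithin_le_nhds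
    · filter_upwards [self_mem_nhdsWithin] with t ht
      show c ^ 2 * t < 0
      exact mul_neg_of_pos_of_neg (by positivity) ht
  have := (hlim.comp hmap).const_smul c
  simpa [nsRescale, Function.comp_def] using this

end Summit.NavierStokesRegularity.NavierStokesRegularity.Cruxes.BlowupTypeIDssProfile.Strategist

end
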